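/-
Copyright (c) 2026 the pub-hodgecm-mathlib formalisation cell (harness21).  Prover seat hodgecm-mathlib-K2E1-p13 (g2), Track B ∕ K2-LIT, h413 = `stmt-HodgeConjecture-24833`,
line `K2_E1_TraceFormulaBeta`, ROADCARD «5Res ENDGAME BY FAMILIES» (dealer K2E1-plan (g7) (214)∕(229)∕(232)): the TUBE LETTER `htube` of ★ `K2E1ChiScatteringConjSymmetryCMTwo` PAID modulo
the reality of the sections — (H1) ★ + (H2) ★ assembled on `U(1,1)`.
-/
import Summits.HodgeConjecture.HodgeConjecture.Theorems.K2E1QuasiSplitGaloisTwistUnipotentTwo   -- ★ (H2) FILE 2 p860235 (this seat): `integral_flatSectionU_comp_galTwist_two`, brings FILE 1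
import Summits.HodgeConjecture.HodgeConjecture.Theorems.K2E1ChiScatteringConjSymmetryCMTwo          -- ★ FILE A p860146 (this seat): (H1) `conj_flatSectionU`, and the consumer `apply_conj_eq_conj_apply_of_tube_of_poleSet`
import HarnessLib

/-!
# `K2E1ChiScatteringConjSymmetryTubeU2` — THE TUBE IDENTITY `conj c(z) = c(conj z)` OF THE GODEMENT-RANGE SCATTERING SCALAR OF `U(1,1)`, FROM (H1)+(H2) AND THE REALITY OF THE SECTIONS

Track B ∕ K2-LIT, crux h413 = `stmt-HodgeConjecture-24833`, route of record `HCCMUnconditional`; cell `hodgecm-mathlib`, squad K2, ENGINE E1.  THEOREMS ONLY (no `def`, no `instance`,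
no `notation`, no `sorry`; default heartbeats); lane `--supports stmt-HodgeConjecture-24833 --as helper` (count-neutral).  Generic `(F, E, c)`, `N = 2`, hypothesis-first on the Galois twist
`(cG, hcG)` of ★ `exists_galTwist`.

THE MATHEMATICS ([MoeglinWaldspurger1995, II.1.6–II.1.7, IV.1.10]; [Langlands1976, §7]).  At the rank-one datum the Godement-range scattering scalar of the datum `(φ, φ′)` is
`c(z) = r·φ′(1)⁻¹·∫_{N(𝔸)} f_z^φ(w₀ v) dν(v)` (`r = (ν𝓕)⁻¹` real; ★ X1_χ §2a's `hbX` evaluated at `g = 1`).  With (H1) `conj f_z^φ = f_{conj z}^{conj∘φ}` (★ FILE A `conj_flatSectionU`), the REALITY of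
the sections **(hreal)** `conj ∘ φ = φ ∘ c_G`, `conj φ′(1) = φ′(1)` (true for the normalised sections of a self-dual unitary `χ` at level `K_max` — (H3), to be paid with the `K_max`-stability
letter (K)), and (H2) ★ `integral_flatSectionU_comp_galTwist_two` (`∫ f^{φ∘c_G}_w(w₀ v g) = ∫ f^φ_w(w₀ v c_G(g))`, at `g = 1`, `c_G(1) = 1`):
**`conj c(z) = c(conj z)`** for EVERY `z` — hence the tube letter `htube : ∀ z, 1 < Re z → s(conj z) = conj s(z)` for any scalar `s` given by this formula on the tube (`Re (conj z) = Re z`).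
* §1 **`conj_godementScalar_eq_of_real`** — the identity for the explicit scalar; §2 **`htube_of_godementScalar`** — the letter shape of ★ `apply_conj_eq_conj_apply_of_tube_of_poleSet`.
HONEST LABEL: HC_CM is proved only modulo the 7 printed citations (2 remaining named inputs: hLiu418 = `stmt-HodgeConjecture-24832`, h413 = `stmt-HodgeConjecture-24833`) until rung 0
closes; this file asserts no named fact, closes no socket; count-neutral; letters `hreal`, `hreal′` ((H3)).
[cite: MoeglinWaldspurger1995, II.1.6–II.1.7 and IV.1.10] [cite: Langlands1976, §7]

## References
* [MoeglinWaldspurger1995] C. Mœglin, J.-L. Waldspurger, *Spectral decomposition and Eisenstein series* (1995), II.1.6–II.1.7, IV.1.10.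
* [Langlands1976] R. P. Langlands, *On the Functional Equations Satisfied by Eisenstein Series*, LNM 544 (1976), §7.
-/

set_option autoImplicit false
set_option linter.dupNamespace false  -- the mandated namespace repeats the summit's segment (`HodgeConjecture.HodgeConjecture`)

noncomputable section

open NumberField IsDedekindDomain MeasureTheory
open scoped NNReal MatrixGroups ComplexConjugate
open Literature.NumberTheory.Automorphic Literature.NumberTheory.Automorphic.UnitaryGroup AdelicGroupData
open Summit.HodgeConjecture.HodgeConjecture.Cruxes.H413.K2E1BorelEisensteinU
open Summit.HodgeConjecture.HodgeConjecture.Cruxes.H413.K2E1QuasiSplitGaloisTwistU2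
open Summit.HodgeConjecture.HodgeConjecture.Cruxes.H413.K2E1QuasiSplitGaloisTwistUnipotentTwo (integral_flatSectionU_comp_galTwist_two)
open Summit.HodgeConjecture.HodgeConjecture.Cruxes.H413.K2E1ChiScatteringConjSymmetryCMTwo (conj_flatSectionU)

namespace Summit.HodgeConjecture.HodgeConjecture.Cruxes.H413.K2E1ChiScatteringConjSymmetryTubeU2

variable {F E : Type} [Field F] [NumberField F] [Field E] [NumberField E] [Algebra F E] {c : E ≃ₐ[F] E}

/-- **§1 `conj c(z) = c(conj z)` FOR THE GODEMENT-RANGE SCALAR `c(z) = r·φ′(1)⁻¹·∫_{N(𝔸)} f_z^φ(w₀ v) dν`** of a datum with `c_G`-REAL sections (`conj ∘ φ = φ ∘ c_G`, `conj φ′(1) = φ′(1)`):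
(H1) conjugate the integrand, (hreal) rewrite `conj∘φ = φ∘c_G`, (H2) ★ `integral_flatSectionU_comp_galTwist_two` at `g = 1`. [cite: MoeglinWaldspurger1995, II.1.7, IV.1.10] [cite: Langlands1976, §7] -/
theorem conj_godementScalar_eq_of_real (hc : c * c = 1) {cG : (quasiSplit F E c 2).Adelic →* (quasiSplit F E c 2).Adelic}
    (hcG : ∀ g, adelicVal F E c 2 _ (cG g) = Matrix.GeneralLinearGroup.map (conjAdele F E c) (adelicVal F E c 2 _ g))
    [MeasurableSpace (quasiSplit F E c 2).Adelic] [BorelSpace (quasiSplit F E c 2).Adelic] (ν : Measure ↥(adelicUnipotent F E c 2)) [ν.IsInvInvariant]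
    (r : ℝ) {φ φ' : (quasiSplit F E c 2).Adelic → ℂ} (hreal : ∀ g, conj (φ g) = φ (cG g)) (hreal' : conj (φ' 1) = φ' 1) (z : ℂ) :
    conj (((r : ℝ) : ℂ) * ((φ' 1)⁻¹ * ∫ v : ↥(adelicUnipotent F E c 2), flatSectionU φ z
        ((quasiSplit F E c 2).toAdelic (weylLongU (c : E →+* E) (rfl : (StdForm.antidiagonal 2).over E = (StdForm.antidiagonal 2).over E)) * ((v : (quasiSplit F E c 2).Adelic) * 1)) ∂ν)) =
      ((r : ℝ) : ℂ) * ((φ' 1)⁻¹ * ∫ v : ↥(adelicUnipotent F E c 2), flatSectionU φ (conj z)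
        ((quasiSplit F E c 2).toAdelic (weylLongU (c : E →+* E) (rfl : (StdForm.antidiagonal 2).over E = (StdForm.antidiagonal 2).over E)) * ((v : (quasiSplit F E c 2).Adelic) * 1)) ∂ν) := by
  have hφ : (fun x => conj (φ x)) = fun x => φ (cG x) := funext hreal
  have hpt : ∀ v : ↥(adelicUnipotent F E c 2), conj (flatSectionU φ z
      ((quasiSplit F E c 2).toAdelic (weylLongU (c : E →+* E) (rfl : (StdForm.antidiagonal 2).over E = (StdForm.antidiagonal 2).over E)) * ((v : (quasiSplit F E c 2).Adelic) * 1))) =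
      flatSectionU (fun x => φ (cG x)) (conj z)
        ((quasiSplit F E c 2).toAdelic (weylLongU (c : E →+* E) (rfl : (StdForm.antidiagonal 2).over E = (StdForm.antidiagonal 2).over E)) * ((v : (quasiSplit F E c 2).Adelic) * 1)) := fun v => by
    rw [conj_flatSectionU, hφ]
  rw [map_mul, Complex.conj_ofReal, map_mul, map_inv₀, hreal', ← integral_conj]
  congr 2
  calc ∫ v : ↥(adelicUnipotent F E c 2), conj (flatSectionU φ z
          ((quasiSplit F E c 2).toAdelic (weylLongU (c : E →+* E) (rfl : (StdForm.antidiagonal 2).over E = (StdForm.antidiagonal 2).over E)) * ((v : (quasiSplit F E c 2).Adelic) * 1))) ∂ν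
        = ∫ v : ↥(adelicUnipotent F E c 2), flatSectionU (fun x => φ (cG x)) (conj z)
          ((quasiSplit F E c 2).toAdelic (weylLongU (c : E →+* E) (rfl : (StdForm.antidiagonal 2).over E = (StdForm.antidiagonal 2).over E)) * ((v : (quasiSplit F E c 2).Adelic) * 1)) ∂ν :=
          integral_congr_ae (Filter.Eventually.of_forall hpt)
    _ = ∫ v : ↥(adelicUnipotent F E c 2), flatSectionU φ (conj z)
          ((quasiSplit F E c 2).toAdelic (weylLongU (c : E →+* E) (rfl : (StdForm.antidiagonal 2).over E = (StdForm.antidiagonal 2).over E)) * ((v : (quasiSplit F E c 2).Adelic) * cG 1)) ∂ν :=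
          integral_flatSectionU_comp_galTwist_two hc hcG ν φ (conj z) 1
    _ = _ := by rw [map_one]

/-- **§2 THE TUBE LETTER `htube`**: any scalar `s` given on the tube `{1 < Re z}` by the Godement-range formula of a datum with `c_G`-real sections satisfies `s(conj z) = conj s(z)` there
(the hypothesis of ★ `K2E1ChiScatteringConjSymmetryCMTwo.apply_conj_eq_conj_apply_of_tube_of_poleSet`). [cite: MoeglinWaldspurger1995, IV.1.10] [cite: Langlands1976, §7] -/
theorem htube_of_godementScalar (hc : c * c = 1) {cG : (quasiSplit F E c 2).Adelic →* (quasiSplit F E c 2).Adelic}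
    (hcG : ∀ g, adelicVal F E c 2 _ (cG g) = Matrix.GeneralLinearGroup.map (conjAdele F E c) (adelicVal F E c 2 _ g))
    [MeasurableSpace (quasiSplit F E c 2).Adelic] [BorelSpace (quasiSplit F E c 2).Adelic] (ν : Measure ↥(adelicUnipotent F E c 2)) [ν.IsInvInvariant]
    (r : ℝ) {φ φ' : (quasiSplit F E c 2).Adelic → ℂ} (hreal : ∀ g, conj (φ g) = φ (cG g)) (hreal' : conj (φ' 1) = φ' 1) {s : ℂ → ℂ}
    (hs : ∀ z : ℂ, 1 < z.re → s z = ((r : ℝ) : ℂ) * ((φ' 1)⁻¹ * ∫ v : ↥(adelicUnipotent F E c 2), flatSectionU φ z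
        ((quasiSplit F E c 2).toAdelic (weylLongU (c : E →+* E) (rfl : (StdForm.antidiagonal 2).over E = (StdForm.antidiagonal 2).over E)) * ((v : (quasiSplit F E c 2).Adelic) * 1)) ∂ν)) :
    ∀ z : ℂ, 1 < z.re → s (conj z) = conj (s z) := by
  intro z hz
  have hz' : 1 < (conj z).re := by rwa [Complex.conj_re]
  rw [hs z hz, hs (conj z) hz', conj_godementScalar_eq_of_real hc hcG ν r hreal hreal' z]

end Summit.HodgeConjecture.HodgeConjecture.Cruxes.H413.K2E1ChiScatteringConjSymmetryTubeU2

end
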